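import Mathlib
import HarnessLib
import Summits.HubbardSuperconductivity.HubbardSuperconductivity.Theorems.KLProgrammeKLRegimeEngineLastStepResponseDoor
import Summits.HubbardSuperconductivity.HubbardSuperconductivity.Theorems.KLProgrammeKLRegimeEngineLastStepResponseFit

/-!
# K3 gen-8-FLOW (stmt 20437, stub (C), located item #20, cure (δ′) «LAST-STEP SWAP», layer F3b): THE RESPONSE BRACKET `(hRdiff, hR, heR0)` —
# the door (C2) composed with the fit (F3a): `C⁴` + `|∂ᵏR(θ)| ≤ curveJetBar e_R e_R′ U k (m+1)` for all `θ`, `k ≤ 4`, `e_R = (0,1,1,1,1)`, `e_R′ = (1,0,0,0,0)`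

Cell gate-hubbard-kl, seat p2 g17.  This is the p2 deliverable to k3c3-p1's receiver `twoLegReadPriv_flow_succ_of_swap_lit` (p606560): its hypotheses `hRdiff`,
`hR` (with `eR := fun k => if k = 0 then 0 else 1`, `eR' := fun k => if k = 0 then 1 else 0`, `heR0 := lastResponse_eR_zero`) for the literal response
`R(θ) = SI(σ_N[Kn] − K̂n)(γ θ) − SI(σ_N[Ko] − K̂o)(γ θ)` (`γ = toLp ∘ klFermiPoint μ Ko`, `Ko = K_{n_β}`, `Kn = K_N`, `N = m + 1`, `m = n_β`; `evalM_apply` is `rfl`),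
from: the curve (`C⁴`, on the old Fermi curve, jets `Dc` uniformly in `θ`), the tangential dressing parameter `t = (Kn ⊖ Ko)∘γ/ω₀` (`|t| ≤ ZU/4^m`,
`|t⁽ⁱ⁾| ≤ (ZU/4^m)·4^{im}`), `ω₀ = π/β ≤ Z/4^m`, the three symbols' sups `Dg_X, A₀_X` (order `Mg ≥ 8`), the three data's moments `Mm_X` / alias tails `Ms_X`,
the layer-A rows `AL_X`, Bell rows `PP_X` (structural, from `(Dc, Mm_X)`) with SIZES `PP_a j ≤ Z·4^{jm}`, `PP_b j ≤ Z·U·4^{jm}`, `PP_c j ≤ Z·U²·4^{jm}/4^m`,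
Bell rows `AA_X` (structural, from `(Dc, AL_X)`) with sizes `AA_X k ≤ Z·U³·4^{km}/4^{2m}`, and ONE smallness `2⁴³·Z⁵·U ≤ 1` (implied by `U ≤ klLastRespU P R` whenever
`2⁴³Z⁵ ≤` its denominator, `lastResponse_rows_fit_of_le_klLastRespU`).

* §1 `bellRows_nonneg` (the structural Bell rows are nonnegative); §2 `bracket_currency_facts`, `moments_table_nonneg`;
* §3 **`lastResponse_bracket`** — THE BRACKET.

Composition only; no definitions; no sizes asserted beyond the hypotheses; nothing asserts superconductivity.
Refs: BGM 2006 §2.2 (2.23), §2.4 (2.36)–(2.42) [cite: BenfattoGiulianiMastropietro2006]; FST 1996 §1 [cite: FeldmanSalmhoferTrubowitz1996].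
-/

noncomputable section

namespace Summit.HubbardSuperconductivity.HubbardSuperconductivity.Theorems.EngineV8

set_option linter.dupNamespace false -- summit = problem name (single-conjunct summit), D-0017

open Complex Real Finset Filter Literature.MathematicalPhysics.QuantumLattice Literature.Probability.LatticeModels
open Literature.Analysis.Fourier Literature.Analysis.Calculus
open Summit.HubbardSuperconductivity.HubbardSuperconductivity.Theorems.KLRegimeSplit
open Summit.HubbardSuperconductivity.HubbardSuperconductivity.Theorems.DispersionFlow
open Summit.HubbardSuperconductivity.HubbardSuperconductivity.Theorems.KLProgrammeLegKernels
open Summit.HubbardSuperconductivity.HubbardSuperconductivity.Theorems.PerturbedFermiCurve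

variable {L M : ℕ} [NeZero L]

/-! ## §1 Nonnegativity of the structural Bell rows -/

omit [NeZero L] in
/-- Bell rows above nonnegative polynomials of nonnegative tables are nonnegative. -/
theorem bellRows_nonneg {Mm Dc PP : ℕ → ℝ} (hMm : ∀ j ≤ 4, 0 ≤ Mm j) (hDc : ∀ i, 1 ≤ i → i ≤ 4 → 0 ≤ Dc i)
    (hPP0 : Mm 0 ≤ PP 0) (hPP1 : Mm 1 * Dc 1 ≤ PP 1) (hPP2 : Mm 2 * Dc 1 ^ 2 + Mm 1 * Dc 2 ≤ PP 2)
    (hPP3 : Mm 3 * Dc 1 ^ 3 + 3 * Mm 2 * Dc 1 * Dc 2 + Mm 1 * Dc 3 ≤ PP 3)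
    (hPP4 : Mm 4 * Dc 1 ^ 4 + 6 * Mm 3 * Dc 1 ^ 2 * Dc 2 + 3 * Mm 2 * Dc 2 ^ 2 + 4 * Mm 2 * Dc 1 * Dc 3 + Mm 1 * Dc 4 ≤ PP 4) :
    ∀ j ≤ 4, 0 ≤ PP j := by
  have h0 := hMm 0 (by norm_num); have h1 := hMm 1 (by norm_num); have h2 := hMm 2 (by norm_num)
  have h3 := hMm 3 (by norm_num); have h4 := hMm 4 (by norm_num)
  have d1 := hDc 1 le_rfl (by norm_num); have d2 := hDc 2 (by norm_num) (by norm_num)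
  have d3 := hDc 3 (by norm_num) (by norm_num); have d4 := hDc 4 (by norm_num) le_rfl
  intro j hj
  interval_cases j
  · exact h0.trans hPP0
  · exact (mul_nonneg h1 d1).trans hPP1
  · exact le_trans (by positivity) hPP2
  · exact le_trans (by positivity) hPP3
  · exact le_trans (by positivity) hPP4

/-! ## §2 Arithmetic of the one-constant currency, and nonnegativity of moment tables -/

omit [NeZero L] in
/-- The side facts of the currency: `0 ≤ ZU/4^m`, `ZU/4^m + ZU/4^m ≤ 1`, `… ≤ 2ZU/4^m`, `1 ≤ 4^m`, `0 ≤ Z` under `0 < U`, `1 ≤ Z`, `2⁴³Z⁵U ≤ 1`. -/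
theorem bracket_currency_facts {U Z : ℝ} (hU : 0 < U) (hZ : 1 ≤ Z) (hUZ : 2 ^ 43 * Z ^ 5 * U ≤ 1) (m : ℕ) :
    0 ≤ Z * U / (4 : ℝ) ^ m ∧ Z * U / (4 : ℝ) ^ m + Z * U / (4 : ℝ) ^ m ≤ 1 ∧
    Z * U / (4 : ℝ) ^ m + Z * U / (4 : ℝ) ^ m ≤ 2 * Z * U / (4 : ℝ) ^ m ∧ (1 : ℝ) ≤ (4 : ℝ) ^ m ∧ 0 ≤ Z := by
  have hl : (1 : ℝ) ≤ (4 : ℝ) ^ m := one_le_pow₀ (by norm_num)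
  have hlpos : (0 : ℝ) < (4 : ℝ) ^ m := by positivity
  have hZ0 : 0 ≤ Z := by linarith
  have hZ5 : Z ≤ Z ^ 5 := by
    calc Z = Z ^ 1 := (pow_one Z).symm
      _ ≤ Z ^ 5 := pow_le_pow_right₀ hZ (by norm_num)
  have h243 : (2 : ℝ) ≤ 2 ^ 43 := by norm_num
  have hZU : 2 * Z * U ≤ 1 := by
    have h1 : 2 * Z * U ≤ 2 ^ 43 * Z ^ 5 * U := by
      have := mul_le_mul h243 hZ5 hZ0 (by norm_num)
      exact mul_le_mul_of_nonneg_right this hU.le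
    exact h1.trans hUZ
  refine ⟨by positivity, ?_, le_of_eq (by ring), hl, hZ0⟩
  rw [← add_div, div_le_iff₀ hlpos]
  calc Z * U + Z * U = 2 * Z * U := by ring
    _ ≤ 1 := hZU
    _ ≤ 1 * (4 : ℝ) ^ m := by rw [one_mul]; exact hl

/-- A moment table above nonnegative sums is nonnegative. -/
theorem moments_table_nonneg (h : TorusSite 2 L → ℝ) {Mm : ℕ → ℝ}
    (hMm : ∀ m ≤ 4, ∑ x : TorusSite 2 L, (1 + ((x 0).valMinAbs.natAbs : ℝ) + ((x 1).valMinAbs.natAbs : ℝ)) ^ m *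
      ‖torusFourierInv (fun k => ((h k : ℝ) : ℂ)) x‖ ≤ Mm m) : ∀ j ≤ 4, 0 ≤ Mm j :=
  fun j hj => (sum_nonneg fun x _ => by positivity).trans (hMm j hj)

/-! ## §3 The bracket -/

section Bracket

variable [NeZero M] {β : ℝ} (hβ : 0 < β) {U : ℝ} (hU : 0 < U) (μ : ℝ) (Ko Kn : TrigPolyC4v) {N : ℕ} (hN : nScales β < N)
  (hZn : IsUnit (effPartitionFn ℂ (normalCovariance L M (uvSymbolCT L M β μ Kn (klScale klE0 N)))
    (hubbardInteraction L M β U + counterQuadratic L M β Kn)))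
  (hZo : IsUnit (effPartitionFn ℂ (normalCovariance L M (uvSymbolCT L M β μ Ko (klScale klE0 N)))
    (hubbardInteraction L M β U + counterQuadratic L M β Ko)))
include hβ hU hN hZn hZo

/-- **THE RESPONSE BRACKET `(hRdiff, hR)`.**  See the module docstring for the inputs; `m = n_β`, `N = m + 1` in the application (any `N > n_β` here). -/
theorem lastResponse_bracket {γ : ℝ → Momentum} (hγ : ContDiff ℝ 4 γ) (hcurve : ∀ θ : ℝ, frameLevel μ Ko (γ θ) = 0)
    {Dc : ℕ → ℝ} (hDc : ∀ θ : ℝ, ∀ i, 1 ≤ i → i ≤ 4 → ‖iteratedDeriv i γ θ‖ ≤ Dc i)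
    (m : ℕ) {Z : ℝ} (hZ : 1 ≤ Z) (hUZ : 2 ^ 43 * Z ^ 5 * U ≤ 1) (hω : Real.pi / β ≤ Z / ((4 : ℝ) ^ m))
    (ht0 : ∀ θ : ℝ, |(fun θ' : ℝ => evalM (fsub Kn Ko) (γ θ') / (Real.pi / β)) θ| ≤ Z * U / ((4 : ℝ) ^ m))
    (htd : ∀ θ : ℝ, ∀ i, 1 ≤ i → i ≤ 4 → |iteratedDeriv i (fun θ' : ℝ => evalM (fsub Kn Ko) (γ θ') / (Real.pi / β)) θ| ≤ (Z * U / ((4 : ℝ) ^ m)) * ((4 : ℝ) ^ m) ^ i)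
    {Mg : ℕ} (hMg : 8 ≤ Mg) {s : ℕ}
    {Dga : ℝ} (hDga : ∀ q, ‖iteratedFDeriv ℝ Mg (fun q : Momentum => ((((evalM (fsub Ko Kn) q * evalM (fsub Ko Kn) q) / (β * (L : ℝ) ^ 2) : ℝ)) : ℂ) * (((uvWeightFn (klScale klE0 N)
        (matsubaraFreq β M (omega0 M)) (frameLevel μ Ko q) : ℝ) : ℂ) * resolventFnXi (β * (L : ℝ) ^ 2) 0 (matsubaraFreq β M (omega0 M)) (frameLevel μ Ko q + uvWeightFn (klScale klE0 N)
        (matsubaraFreq β M (omega0 M)) (frameLevel μ Ko q) * evalM (fsub Ko Kn) q))) q‖ ≤ Dga) {A₀a : ℝ} (hA₀a : ∀ q, ‖(fun q : Momentum => ((((evalM (fsub Ko Kn) q * evalM (fsub Ko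
        Kn) q) / (β * (L : ℝ) ^ 2) : ℝ)) : ℂ) * (((uvWeightFn (klScale klE0 N) (matsubaraFreq β M (omega0 M)) (frameLevel μ Ko q) : ℝ) : ℂ) * resolventFnXi (β * (L : ℝ) ^ 2) 0
        (matsubaraFreq β M (omega0 M)) (frameLevel μ Ko q + uvWeightFn (klScale klE0 N) (matsubaraFreq β M (omega0 M)) (frameLevel μ Ko q) * evalM (fsub Ko Kn) q))) q‖ ≤ A₀a)
    {Mma : ℕ → ℝ} (hMma : ∀ m ≤ 4, ∑ x : TorusSite 2 L, (1 + ((x 0).valMinAbs.natAbs : ℝ) + ((x 1).valMinAbs.natAbs : ℝ)) ^ m *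
      ‖torusFourierInv (fun k => ((((fun _ : TorusSite 2 L => (1 : ℝ)) k : ℝ)) : ℂ)) x‖ ≤ Mma m)
    {Msa : ℝ} (hMsa : ∑ x : TorusSite 2 L, (1 + ((x 0).valMinAbs.natAbs : ℝ) + ((x 1).valMinAbs.natAbs : ℝ)) ^ s *
      ‖torusFourierInv (fun k => ((((fun _ : TorusSite 2 L => (1 : ℝ)) k : ℝ)) : ℂ)) x‖ ≤ Msa)
    {Dgb : ℝ} (hDgb : ∀ q, ‖iteratedFDeriv ℝ Mg (fun q : Momentum => ((((evalM (fsub Ko Kn) q / (β * (L : ℝ) ^ 2) : ℝ)) : ℂ) * (((uvWeightFn (klScale klE0 N) (matsubaraFreq β M (omega0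
        M)) (frameLevel μ Ko q) : ℝ) : ℂ) * resolventFnXi (β * (L : ℝ) ^ 2) 0 (matsubaraFreq β M (omega0 M)) (frameLevel μ Ko q + uvWeightFn (klScale klE0 N) (matsubaraFreq β M (omega0
        M)) (frameLevel μ Ko q) * evalM (fsub Ko Kn) q))) * ((((evalM (fsub Ko Kn) q / (β * (L : ℝ) ^ 2) : ℝ)) : ℂ) * (((uvWeightFn (klScale klE0 N) (matsubaraFreq β M (omega0 M))
        (frameLevel μ Ko q) : ℝ) : ℂ) * resolventFnXi (β * (L : ℝ) ^ 2) 0 (matsubaraFreq β M (omega0 M)) (frameLevel μ Ko q + uvWeightFn (klScale klE0 N) (matsubaraFreq β M (omega0 M))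
        (frameLevel μ Ko q) * evalM (fsub Ko Kn) q))) - (2 : ℂ) * ((((evalM (fsub Ko Kn) q / (β * (L : ℝ) ^ 2) : ℝ)) : ℂ) * (((uvWeightFn (klScale klE0 N) (matsubaraFreq β M (omega0
        M)) (frameLevel μ Ko q) : ℝ) : ℂ) * resolventFnXi (β * (L : ℝ) ^ 2) 0 (matsubaraFreq β M (omega0 M)) (frameLevel μ Ko q + uvWeightFn (klScale klE0 N) (matsubaraFreq β M (omega0
        M)) (frameLevel μ Ko q) * evalM (fsub Ko Kn) q)))) q‖ ≤ Dgb) {A₀b : ℝ} (hA₀b : ∀ q, ‖(fun q : Momentum => ((((evalM (fsub Ko Kn) q / (β * (L : ℝ) ^ 2) : ℝ)) : ℂ) *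
        (((uvWeightFn (klScale klE0 N) (matsubaraFreq β M (omega0 M)) (frameLevel μ Ko q) : ℝ) : ℂ) * resolventFnXi (β * (L : ℝ) ^ 2) 0 (matsubaraFreq β M (omega0 M)) (frameLevel μ Ko
        q + uvWeightFn (klScale klE0 N) (matsubaraFreq β M (omega0 M)) (frameLevel μ Ko q) * evalM (fsub Ko Kn) q))) * ((((evalM (fsub Ko Kn) q / (β * (L : ℝ) ^ 2) : ℝ)) : ℂ) *
        (((uvWeightFn (klScale klE0 N) (matsubaraFreq β M (omega0 M)) (frameLevel μ Ko q) : ℝ) : ℂ) * resolventFnXi (β * (L : ℝ) ^ 2) 0 (matsubaraFreq β M (omega0 M)) (frameLevel μ Ko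
        q + uvWeightFn (klScale klE0 N) (matsubaraFreq β M (omega0 M)) (frameLevel μ Ko q) * evalM (fsub Ko Kn) q))) - (2 : ℂ) * ((((evalM (fsub Ko Kn) q / (β * (L : ℝ) ^ 2) : ℝ)) : ℂ)
        * (((uvWeightFn (klScale klE0 N) (matsubaraFreq β M (omega0 M)) (frameLevel μ Ko q) : ℝ) : ℂ) * resolventFnXi (β * (L : ℝ) ^ 2) 0 (matsubaraFreq β M (omega0 M)) (frameLevel μ
        Ko q + uvWeightFn (klScale klE0 N) (matsubaraFreq β M (omega0 M)) (frameLevel μ Ko q) * evalM (fsub Ko Kn) q)))) q‖ ≤ A₀b)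
    {Mmb : ℕ → ℝ} (hMmb : ∀ m ≤ 4, ∑ x : TorusSite 2 L, (1 + ((x 0).valMinAbs.natAbs : ℝ) + ((x 1).valMinAbs.natAbs : ℝ)) ^ m *
      ‖torusFourierInv (fun k => ((((fun k : TorusSite 2 L => klLocSelfEnergyRe L M β U μ Kn N k) k : ℝ)) : ℂ)) x‖ ≤ Mmb m)
    {Msb : ℝ} (hMsb : ∑ x : TorusSite 2 L, (1 + ((x 0).valMinAbs.natAbs : ℝ) + ((x 1).valMinAbs.natAbs : ℝ)) ^ s *
      ‖torusFourierInv (fun k => ((((fun k : TorusSite 2 L => klLocSelfEnergyRe L M β U μ Kn N k) k : ℝ)) : ℂ)) x‖ ≤ Msb)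
    {Dgc : ℝ} (hDgc : ∀ q, ‖iteratedFDeriv ℝ Mg (fun q : Momentum => -I * (((((evalM (fsub Ko Kn) q / (β * (L : ℝ) ^ 2) : ℝ)) : ℂ) * (((uvWeightFn (klScale klE0 N) (matsubaraFreq β M
        (omega0 M)) (frameLevel μ Ko q) : ℝ) : ℂ) * resolventFnXi (β * (L : ℝ) ^ 2) 0 (matsubaraFreq β M (omega0 M)) (frameLevel μ Ko q + uvWeightFn (klScale klE0 N) (matsubaraFreq β M
        (omega0 M)) (frameLevel μ Ko q) * evalM (fsub Ko Kn) q))) * ((((evalM (fsub Ko Kn) q / (β * (L : ℝ) ^ 2) : ℝ)) : ℂ) * (((uvWeightFn (klScale klE0 N) (matsubaraFreq β M (omega0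
        M)) (frameLevel μ Ko q) : ℝ) : ℂ) * resolventFnXi (β * (L : ℝ) ^ 2) 0 (matsubaraFreq β M (omega0 M)) (frameLevel μ Ko q + uvWeightFn (klScale klE0 N) (matsubaraFreq β M (omega0
        M)) (frameLevel μ Ko q) * evalM (fsub Ko Kn) q))) - (2 : ℂ) * ((((evalM (fsub Ko Kn) q / (β * (L : ℝ) ^ 2) : ℝ)) : ℂ) * (((uvWeightFn (klScale klE0 N) (matsubaraFreq β M
        (omega0 M)) (frameLevel μ Ko q) : ℝ) : ℂ) * resolventFnXi (β * (L : ℝ) ^ 2) 0 (matsubaraFreq β M (omega0 M)) (frameLevel μ Ko q + uvWeightFn (klScale klE0 N) (matsubaraFreq β M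
        (omega0 M)) (frameLevel μ Ko q) * evalM (fsub Ko Kn) q))))) q‖ ≤ Dgc) {A₀c : ℝ} (hA₀c : ∀ q, ‖(fun q : Momentum => -I * (((((evalM (fsub Ko Kn) q / (β * (L : ℝ) ^ 2) : ℝ)) : ℂ)
        * (((uvWeightFn (klScale klE0 N) (matsubaraFreq β M (omega0 M)) (frameLevel μ Ko q) : ℝ) : ℂ) * resolventFnXi (β * (L : ℝ) ^ 2) 0 (matsubaraFreq β M (omega0 M)) (frameLevel μ
        Ko q + uvWeightFn (klScale klE0 N) (matsubaraFreq β M (omega0 M)) (frameLevel μ Ko q) * evalM (fsub Ko Kn) q))) * ((((evalM (fsub Ko Kn) q / (β * (L : ℝ) ^ 2) : ℝ)) : ℂ) *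
        (((uvWeightFn (klScale klE0 N) (matsubaraFreq β M (omega0 M)) (frameLevel μ Ko q) : ℝ) : ℂ) * resolventFnXi (β * (L : ℝ) ^ 2) 0 (matsubaraFreq β M (omega0 M)) (frameLevel μ Ko
        q + uvWeightFn (klScale klE0 N) (matsubaraFreq β M (omega0 M)) (frameLevel μ Ko q) * evalM (fsub Ko Kn) q))) - (2 : ℂ) * ((((evalM (fsub Ko Kn) q / (β * (L : ℝ) ^ 2) : ℝ)) : ℂ)
        * (((uvWeightFn (klScale klE0 N) (matsubaraFreq β M (omega0 M)) (frameLevel μ Ko q) : ℝ) : ℂ) * resolventFnXi (β * (L : ℝ) ^ 2) 0 (matsubaraFreq β M (omega0 M)) (frameLevel μ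
        Ko q + uvWeightFn (klScale klE0 N) (matsubaraFreq β M (omega0 M)) (frameLevel μ Ko q) * evalM (fsub Ko Kn) q))))) q‖ ≤ A₀c)
    {Mmc : ℕ → ℝ} (hMmc : ∀ m ≤ 4, ∑ x : TorusSite 2 L, (1 + ((x 0).valMinAbs.natAbs : ℝ) + ((x 1).valMinAbs.natAbs : ℝ)) ^ m *
      ‖torusFourierInv (fun k => ((((fun k : TorusSite 2 L => (∑ s : Fin 2, ((klSelfEnergy L M β U μ Kn klE0 N (omega0 M, k) s).im - (klSelfEnergy L M β U μ Kn klE0 N ((omega0 M).rev,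
          k) s).im)) / 4) k : ℝ)) : ℂ)) x‖ ≤ Mmc m)
    {Msc : ℝ} (hMsc : ∑ x : TorusSite 2 L, (1 + ((x 0).valMinAbs.natAbs : ℝ) + ((x 1).valMinAbs.natAbs : ℝ)) ^ s *
      ‖torusFourierInv (fun k => ((((fun k : TorusSite 2 L => (∑ s : Fin 2, ((klSelfEnergy L M β U μ Kn klE0 N (omega0 M, k) s).im - (klSelfEnergy L M β U μ Kn klE0 N ((omega0 M).rev,
          k) s).im)) / 4) k : ℝ)) : ℂ)) x‖ ≤ Msc)
    {ALa : ℕ → ℝ}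
    (hALa : ∀ j ≤ 4, 2 * (2 * (Mma j * ((3 : ℝ) ^ j * Dga * (2 / ((2 * (L / 4 + 1) : ℕ) : ℝ)) ^ (Mg - j - 4) *
        (2 ^ 2 * ∑' k : Fin 2 → ℤ, ∏ i, (1 + (k i : ℝ) ^ 2)⁻¹)))) + (L : ℝ) ^ 2 * (L : ℝ) ^ j * (A₀a * (Msa / (1 + (L : ℝ) / 4) ^ s)) ≤ ALa j)
    {PPa : ℕ → ℝ} (hPPa0 : Mma 0 ≤ PPa 0) (hPPa1 : Mma 1 * Dc 1 ≤ PPa 1) (hPPa2 : Mma 2 * Dc 1 ^ 2 + Mma 1 * Dc 2 ≤ PPa 2)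
    (hPPa3 : Mma 3 * Dc 1 ^ 3 + 3 * Mma 2 * Dc 1 * Dc 2 + Mma 1 * Dc 3 ≤ PPa 3)
    (hPPa4 : Mma 4 * Dc 1 ^ 4 + 6 * Mma 3 * Dc 1 ^ 2 * Dc 2 + 3 * Mma 2 * Dc 2 ^ 2 + 4 * Mma 2 * Dc 1 * Dc 3 + Mma 1 * Dc 4 ≤ PPa 4)
    {AAa : ℕ → ℝ} (hAAa0 : ALa 0 ≤ AAa 0) (hAAa1 : ALa 1 * Dc 1 ≤ AAa 1) (hAAa2 : ALa 2 * Dc 1 ^ 2 + ALa 1 * Dc 2 ≤ AAa 2)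
    (hAAa3 : ALa 3 * Dc 1 ^ 3 + 3 * ALa 2 * Dc 1 * Dc 2 + ALa 1 * Dc 3 ≤ AAa 3)
    (hAAa4 : ALa 4 * Dc 1 ^ 4 + 6 * ALa 3 * Dc 1 ^ 2 * Dc 2 + 3 * ALa 2 * Dc 2 ^ 2 + 4 * ALa 2 * Dc 1 * Dc 3 + ALa 1 * Dc 4 ≤ AAa 4)
    {ALb : ℕ → ℝ}
    (hALb : ∀ j ≤ 4, 2 * (2 * (Mmb j * ((3 : ℝ) ^ j * Dgb * (2 / ((2 * (L / 4 + 1) : ℕ) : ℝ)) ^ (Mg - j - 4) *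
        (2 ^ 2 * ∑' k : Fin 2 → ℤ, ∏ i, (1 + (k i : ℝ) ^ 2)⁻¹)))) + (L : ℝ) ^ 2 * (L : ℝ) ^ j * (A₀b * (Msb / (1 + (L : ℝ) / 4) ^ s)) ≤ ALb j)
    {PPb : ℕ → ℝ} (hPPb0 : Mmb 0 ≤ PPb 0) (hPPb1 : Mmb 1 * Dc 1 ≤ PPb 1) (hPPb2 : Mmb 2 * Dc 1 ^ 2 + Mmb 1 * Dc 2 ≤ PPb 2)
    (hPPb3 : Mmb 3 * Dc 1 ^ 3 + 3 * Mmb 2 * Dc 1 * Dc 2 + Mmb 1 * Dc 3 ≤ PPb 3)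
    (hPPb4 : Mmb 4 * Dc 1 ^ 4 + 6 * Mmb 3 * Dc 1 ^ 2 * Dc 2 + 3 * Mmb 2 * Dc 2 ^ 2 + 4 * Mmb 2 * Dc 1 * Dc 3 + Mmb 1 * Dc 4 ≤ PPb 4)
    {AAb : ℕ → ℝ} (hAAb0 : ALb 0 ≤ AAb 0) (hAAb1 : ALb 1 * Dc 1 ≤ AAb 1) (hAAb2 : ALb 2 * Dc 1 ^ 2 + ALb 1 * Dc 2 ≤ AAb 2)
    (hAAb3 : ALb 3 * Dc 1 ^ 3 + 3 * ALb 2 * Dc 1 * Dc 2 + ALb 1 * Dc 3 ≤ AAb 3)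
    (hAAb4 : ALb 4 * Dc 1 ^ 4 + 6 * ALb 3 * Dc 1 ^ 2 * Dc 2 + 3 * ALb 2 * Dc 2 ^ 2 + 4 * ALb 2 * Dc 1 * Dc 3 + ALb 1 * Dc 4 ≤ AAb 4)
    {ALc : ℕ → ℝ}
    (hALc : ∀ j ≤ 4, 2 * (2 * (Mmc j * ((3 : ℝ) ^ j * Dgc * (2 / ((2 * (L / 4 + 1) : ℕ) : ℝ)) ^ (Mg - j - 4) *
        (2 ^ 2 * ∑' k : Fin 2 → ℤ, ∏ i, (1 + (k i : ℝ) ^ 2)⁻¹)))) + (L : ℝ) ^ 2 * (L : ℝ) ^ j * (A₀c * (Msc / (1 + (L : ℝ) / 4) ^ s)) ≤ ALc j)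
    {PPc : ℕ → ℝ} (hPPc0 : Mmc 0 ≤ PPc 0) (hPPc1 : Mmc 1 * Dc 1 ≤ PPc 1) (hPPc2 : Mmc 2 * Dc 1 ^ 2 + Mmc 1 * Dc 2 ≤ PPc 2)
    (hPPc3 : Mmc 3 * Dc 1 ^ 3 + 3 * Mmc 2 * Dc 1 * Dc 2 + Mmc 1 * Dc 3 ≤ PPc 3)
    (hPPc4 : Mmc 4 * Dc 1 ^ 4 + 6 * Mmc 3 * Dc 1 ^ 2 * Dc 2 + 3 * Mmc 2 * Dc 2 ^ 2 + 4 * Mmc 2 * Dc 1 * Dc 3 + Mmc 1 * Dc 4 ≤ PPc 4)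
    {AAc : ℕ → ℝ} (hAAc0 : ALc 0 ≤ AAc 0) (hAAc1 : ALc 1 * Dc 1 ≤ AAc 1) (hAAc2 : ALc 2 * Dc 1 ^ 2 + ALc 1 * Dc 2 ≤ AAc 2)
    (hAAc3 : ALc 3 * Dc 1 ^ 3 + 3 * ALc 2 * Dc 1 * Dc 2 + ALc 1 * Dc 3 ≤ AAc 3)
    (hAAc4 : ALc 4 * Dc 1 ^ 4 + 6 * ALc 3 * Dc 1 ^ 2 * Dc 2 + 3 * ALc 2 * Dc 2 ^ 2 + 4 * ALc 2 * Dc 1 * Dc 3 + ALc 1 * Dc 4 ≤ AAc 4)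
    (hPPas : ∀ j ≤ 4, PPa j ≤ Z * ((4 : ℝ) ^ m) ^ j)
    (hPPbs : ∀ j ≤ 4, PPb j ≤ Z * U * ((4 : ℝ) ^ m) ^ j)
    (hPPcs : ∀ j ≤ 4, PPc j ≤ Z * U ^ 2 * ((4 : ℝ) ^ m) ^ j / ((4 : ℝ) ^ m))
    (hAAas : ∀ k ≤ 4, AAa k ≤ Z * U ^ 3 * ((4 : ℝ) ^ m) ^ k / ((4 : ℝ) ^ m) ^ 2) (hAAbs : ∀ k ≤ 4, AAb k ≤ Z * U ^ 3 * ((4 : ℝ) ^ m) ^ k / ((4 : ℝ) ^ m) ^ 2)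
    (hAAcs : ∀ k ≤ 4, AAc k ≤ Z * U ^ 3 * ((4 : ℝ) ^ m) ^ k / ((4 : ℝ) ^ m) ^ 2) :
    ContDiff ℝ 4 (fun θ : ℝ => evalM (symInterp L (fun k => klLocSelfEnergyRe L M β U μ Kn N k - Kn.eval (latticeMomentum L k))) (γ θ) -
        evalM (symInterp L (fun k => klLocSelfEnergyRe L M β U μ Ko N k - Ko.eval (latticeMomentum L k))) (γ θ)) ∧
    ∀ k ≤ 4, ∀ θ : ℝ, |iteratedDeriv k (fun θ : ℝ => evalM (symInterp L (fun k => klLocSelfEnergyRe L M β U μ Kn N k - Kn.eval (latticeMomentum L k))) (γ θ) -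
        evalM (symInterp L (fun k => klLocSelfEnergyRe L M β U μ Ko N k - Ko.eval (latticeMomentum L k))) (γ θ)) θ| ≤
      curveJetBar (fun k => if k = 0 then 0 else 1) (fun k => if k = 0 then 1 else 0) U k (m + 1) := by
  obtain ⟨hη0, h1, hA, hl, hZ0⟩ := bracket_currency_facts hU hZ hUZ m
  -- nonnegativity of the structural tables
  have hDc0 : ∀ i, 1 ≤ i → i ≤ 4 → 0 ≤ Dc i := fun i h1i hi4 => (norm_nonneg _).trans (hDc 0 i h1i hi4)
  have hPPa0' := bellRows_nonneg (moments_table_nonneg (fun _ : TorusSite 2 L => (1 : ℝ)) hMma) hDc0 hPPa0 hPPa1 hPPa2 hPPa3 hPPa4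
  have hPPb0' := bellRows_nonneg (moments_table_nonneg (fun k : TorusSite 2 L => klLocSelfEnergyRe L M β U μ Kn N k) hMmb) hDc0 hPPb0 hPPb1 hPPb2 hPPb3 hPPb4
  have hPPc0' := bellRows_nonneg (moments_table_nonneg (fun k : TorusSite 2 L => (∑ s : Fin 2, ((klSelfEnergy L M β U μ Kn klE0 N (omega0 M, k) s).im - (klSelfEnergy L M β U μ Kn klE0
      N ((omega0 M).rev, k) s).im)) / 4) hMmc) hDc0 hPPc0 hPPc1 hPPc2 hPPc3 hPPc4
  -- the door at every `θ`
  have hdoor := fun θ : ℝ => lastResponse_jets_door (L := L) (M := M) hβ U μ Ko Kn hN hZn hZo hγ hcurve (hDc θ) hη0 hη0 h1 hl (ht0 θ) (htd θ) hMg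
    hDga hA₀a hMma hMsa hDgb hA₀b hMmb hMsb hDgc hA₀c hMmc hMsc
    hALa hPPa0 hPPa1 hPPa2 hPPa3 hPPa4 hAAa0 hAAa1 hAAa2 hAAa3 hAAa4
    hALb hPPb0 hPPb1 hPPb2 hPPb3 hPPb4 hAAb0 hAAb1 hAAb2 hAAb3 hAAb4
    hALc hPPc0 hPPc1 hPPc2 hPPc3 hPPc4 hAAc0 hAAc1 hAAc2 hAAc3 hAAc4
  refine ⟨(hdoor 0).1, fun k hk θ => ?_⟩
  -- the fit
  have hrows := lastResponse_rows_le (ω₀ := Real.pi / β) hU.le hZ hl hη0 hη0 hA (by positivity) hω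
    hPPa0' hPPas hPPb0' hPPbs hPPc0' hPPcs hAAas hAAbs hAAcs k hk
  have hfit := lastResponse_rows_fit_curveJetBar m hU hZ hUZ k hk
  exact ((hdoor θ).2 k hk).trans (hrows.trans hfit)

end Bracket

end Summit.HubbardSuperconductivity.HubbardSuperconductivity.Theorems.EngineV8

end
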